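import Summits.ResolutionOfSingularities.ResolutionOfSingularities.Theorems.CoefficientCutLaws
import HarnessLib

/-!
# CoefficientCutTangency — decomp-res node «CoefficientCut» (lens-5 g19 rev 1) refining the MaxContactCut aside
31770; tree file 3/4 of the node

Content VERBATIM from the decomp-res lens-5 g19 file `HOME/decomp-res-lens-5/g19/CoefficientCut.lean` rev 1 (sha256
e823b9913123731a ≡
`parts/CoefficientCut-NODE-rev1-e823b991.lean`, 759 l; statements identical to the graded NODE pin e42372fd).  HOME =
run/shared/lean/pub/decomp-res.  Critic: CRITIC-LEDGER rows 135 / 135a CLEARED (DECIDED-MOD-PORT(KNOWN) +1 · MAP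
+1), landing orders
2026-08-30T19:29:50Z / 19:36:14Z.  Host: route `MaxContactCut`, aside 31770 `MaxContactCut.DefectWalksDeep` BY NAME
through the tree's
`ExitLaw.defectWalksDeep_iff_joint'` and the lens-5 g18 node `Theorems/PlanarCut*` + `MaxContactCutPlanarCut`.

§3b the FREE-POINT TANGENCY LAW of layer `0` (rows `q < n < 2q`) at a planar move landing in excess: `coeff_step_row_zero`,
`rowPoly_coeff_eq_zero_of_excess`, `row_tangency_at_planar_move`, `row_reach_at_planar_move` and their helpers.  All PROVED.

[WRITER NOTE (decomp-res writer g7): split by the critic's order into `CoefficientCutClasses` (CONE-FREE: the two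
classes whose binders use
only tree-free vocabulary — `NoPlanarJointTailsDeep`, `NoSkewJointTailsDeep` VERBATIM — plus the writer's
cone-free restatement
`NoMonomialLedPlanarJointTailsDeep` of PIECE 1 with the PlanarCut letters `sm (layer k a F) i j = 0` spelled out as
`IsMonomialLed`, so that
the route file can import the two asides; the in-cone wiring file proves the restatement EXACT:
`monomialPlanar_iff_monomialLed`),
`CoefficientCutLaws` (§1–§3, PROVED, imports `MaxContactCutPlanarCut`), `CoefficientCutTangency` (§3b, PROVED)
and `MaxContactCutCoefficientCut`
(§4 VERBATIM: PIECE 1 `NoMonomialPlanarJointTailsDeep` in the lens's letters, the node equation, `closes`, the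
exact cut, necessities — plus the
writer's link §4w).  ONE namespace `…Theorems.CoefficientCut` as in the lens; global `set_option` line dropped;
nothing else changed.]

(Sources: BenitoVillamayor2012 Thm. 2.11, Thm. 3.3, §4; KawanoueMatsuki2016 §4–§5 (arXiv:1205.4556 pp. 2, 5,
7); Hauser2010 §§D–G; HauserPerlega2019; CossartJannsenSaito2020 Thm. 2.14; CossartPiltant2019; Moh1987.)
-/

noncomputable section

open MvPolynomial Finset
open Literature.AlgebraicGeometry.Resolution
open Literature.AlgebraicGeometry.Resolution.Hauser2010
open Literature.AlgebraicGeometry.Resolution.PointBlowup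
open Literature.AlgebraicGeometry.Resolution.WeightedBlowup
open Summit.ResolutionOfSingularities.ResolutionOfSingularities.Theses
open Summit.ResolutionOfSingularities.ResolutionOfSingularities.Theorems.TightDefectClasses
open Summit.ResolutionOfSingularities.ResolutionOfSingularities.Theorems.TightDefectStrongWalks
open Summit.ResolutionOfSingularities.ResolutionOfSingularities.Theorems.ItineraryCutClasses
open Summit.ResolutionOfSingularities.ResolutionOfSingularities.Theorems.BoundaryLedger
open Summit.ResolutionOfSingularities.ResolutionOfSingularities.Theorems.ProximityCut
open Summit.ResolutionOfSingularities.ResolutionOfSingularities.Theorems.ExitLaw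
open Summit.ResolutionOfSingularities.ResolutionOfSingularities.Theorems.PlanarCut

namespace Summit.ResolutionOfSingularities.ResolutionOfSingularities.Theorems.CoefficientCut

/-! ## §3b The FREE-POINT TANGENCY LAW of layer `0` (rows `q < n < 2q`) at a planar move landing in excess -/

section Tangency

variable {K : Type} [Field K] [DecidableEq K]
variable {i j k : Fin 3} (hij : i ≠ j) (hjk : j ≠ k) (hik : i ≠ k)
include hij hjk hik

omit hik in
/-- Layer-`0` exponents on a LOW new row (`0 < d_j < q`) are never `q`-th powers: cleaning does not touch them.
[folklore] -/
theorem not_isPthPowerExponent_exp3_low {q l y : ℕ} (hy0 : 0 < y) (hyq : y < q) :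
    ¬ IsPthPowerExponent q (exp3 i j k l y 0) := by
  rw [isPthPowerExponent_iff]
  intro h
  have h1 := h j
  rw [exp3_j hij hjk] at h1
  have := Nat.le_of_dvd hy0 h1
  omega

/-- **THE LAYER-`0` ROW IDENTITY (PROVED):** under a planar move in the chart `u_j` at `b` (`b_j = b_k = 0`), the
coefficient of the new layer-`0` exponent `(l, n − q, 0)`, `q < n < 2q`, is the `l`-th Taylor coefficient at the
free point `β = b_i` of the ROW POLYNOMIAL of row `n` of the old layer `0` — the tree's `coeff_step_lowest_row`
(positive layers, lowest row) extended to layer `0` and to EVERY low row (cleaning is irrelevant there: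
`not_isPthPowerExponent_exp3_low`). [new] [folklore] -/
theorem coeff_step_row_zero (q : ℕ) (b : Fin 3 → K) (hbj : b j = 0) (hbk : b k = 0) (s : State (Fin 3) K)
    (hF : ∀ d ∈ s.F.support, q ≤ d.degree) {n : ℕ} (hqn : q < n) (hn2 : n < 2 * q) (l : ℕ) :
    coeff (exp3 i j k l (n - q) 0) (step q j b s).F = (rowPoly i j k 0 n (b i) s.F).coeff l := by
  classical
  have hcl : coeff (exp3 i j k l (n - q) 0) (step q j b s).F =
      coeff (exp3 i j k l (n - q) 0) (translate b (chartTransform q j s.F)) := by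
    show coeff _ (deletePthPowers q (pointTransform q j b s)) = _
    rw [coeff_deletePthPowers, if_neg (not_isPthPowerExponent_exp3_low hij hjk (by omega) (by omega))]
    rfl
  rw [hcl, coeff_pointTransform_planar hij hjk hik q b hbj hbk s.F hF, coeff_rowPoly,
    exp3_i hij hik, exp3_j hij hjk, exp3_k hjk hik]
  unfold layer
  rw [Finset.filter_filter]
  refine Finset.sum_congr ?_ fun d _ => rfl
  refine Finset.filter_congr fun d hd => ?_
  have := degree_three hij hjk hik d
  constructor
  · rintro ⟨h1, h2⟩
    exact ⟨h1, by omega⟩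
  · rintro ⟨h1, h2⟩
    exact ⟨h1, by omega⟩

/-- **FREE-POINT TANGENCY LAW, MOVE FORM (PROVED):** if such a move lands in EXCESS (every exponent of the new state
has degree `> q`), then for every row `q < n < 2q` of the old layer `0` the Taylor expansion of its row polynomial at
the free point `β = b_i` vanishes to order `2q − n + 1`: `coeff_l = 0` for all `l ≤ 2q − n`.  (The would-be new
exponent `(l, n − q, 0)` has degree `l + n − q ≤ q`.) [new] [folklore] -/
theorem rowPoly_coeff_eq_zero_of_excess (q : ℕ) (b : Fin 3 → K) (hbj : b j = 0) (hbk : b k = 0)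
    (s : State (Fin 3) K) (hF : ∀ d ∈ s.F.support, q ≤ d.degree)
    (hF' : ∀ d ∈ (step q j b s).F.support, q < d.degree) {n : ℕ} (hqn : q < n) (hn2 : n < 2 * q) {l : ℕ}
    (hl : l + n ≤ 2 * q) : (rowPoly i j k 0 n (b i) s.F).coeff l = 0 := by
  classical
  rw [← coeff_step_row_zero hij hjk hik q b hbj hbk s hF hqn hn2 l]
  by_contra hne
  have h1 := hF' _ (MvPolynomial.mem_support_iff.mpr hne)
  rw [degree_three hij hjk hik, exp3_i hij hik, exp3_j hij hjk, exp3_k hjk hik] at h1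
  omega

/-- **REACH (PROVED):** under the same hypotheses every NON-EMPTY row `q < n < 2q` of the old layer `0` contains an
exponent `d` with `d_i ≥ 2q + 1 − n`: the free point is a root of multiplicity `≥ 2q − n + 1` of the (non-zero) row
polynomial, whose degree is at most the largest `d_i` on the row.  At an untranslated move (`b_i = 0`) this says
EVERY exponent of the row has `d_i ≥ 2q + 1 − n`. [new] [folklore] -/
theorem exists_reach_of_excess (q : ℕ) (b : Fin 3 → K) (hbj : b j = 0) (hbk : b k = 0) (s : State (Fin 3) K)
    (hF : ∀ d ∈ s.F.support, q ≤ d.degree) (hF' : ∀ d ∈ (step q j b s).F.support, q < d.degree) {n : ℕ}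
    (hqn : q < n) (hn2 : n < 2 * q) (hne : ((layer k 0 s.F).filter (fun d => d i + d j = n)).Nonempty) :
    ∃ d ∈ (layer k 0 s.F).filter (fun d => d i + d j = n), 2 * q + 1 ≤ d i + n := by
  classical
  by_contra hno
  push Not at hno
  refine rowPoly_ne_zero hij hjk hik (b i) hne (Polynomial.ext fun l => ?_)
  rw [Polynomial.coeff_zero]
  by_cases hl : l + n ≤ 2 * q
  · exact rowPoly_coeff_eq_zero_of_excess hij hjk hik q b hbj hbk s hF hF' hqn hn2 hl
  · rw [coeff_rowPoly]
    refine Finset.sum_eq_zero fun d hd => ?_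
    have := hno d hd
    rw [Nat.choose_eq_zero_of_lt (by omega : d i < l), Nat.cast_zero, zero_mul, mul_zero]

end Tangency

section TangencyWalk

variable {K : Type} [Field K] [DecidableEq K] {q : ℕ} {s₀ : State (Fin 3) K}
variable {i j k : Fin 3} (hij : i ≠ j) (hjk : j ≠ k) (hik : i ≠ k)
include hij hjk hik

omit hij hjk hik in
/-- On an EXCESS state of a walk from a root (`ord₀ F_t ≠ q`) every exponent has degree `> q`. [folklore] -/
theorem lt_degree_of_excess (hs : IsRoot q s₀) (W : ForcedWalk q s₀) (t : ℕ)
    (hex : ordZero (W.st t).F ≠ (q : ℕ∞)) {d : Fin 3 →₀ ℕ} (hd : d ∈ (W.st t).F.support) : q < d.degree := by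
  obtain ⟨o, ho, hqo⟩ := walk_nat hs W t
  have hoq : o ≠ q := fun h => hex (by rw [ho, h])
  have h1 : (o : ℕ∞) ≤ d.degree := by
    rw [← ho]
    exact not_lt.mp fun h => (MvPolynomial.mem_support_iff.mp hd) (coeff_eq_zero_of_degree_lt_ordZero h)
  have h2 : o ≤ d.degree := by exact_mod_cast h1
  omega

/-- **FREE-POINT TANGENCY LAW (PROVED, walk form):** at any PLANAR move `t` of a forced walk from a root (chart
`u_j`, no `u_k`-translation) whose next state is in EXCESS, every row `q < n < 2q` of layer `0` of `F_t` is tangent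
to order `2q − n + 1` at the free point `β_t = b_t(i)`: `(rowPoly i j k 0 n β_t F_t).coeff l = 0` for `l + n ≤ 2q`.
This is the layer-`0` companion of the tree's free-point laws for the degree-`q` form
(`ExitLaw.coeff_pointTransform_free_top`, `no_free_initial_of_repeat`), one storey up (`q < n < 2q`). [new] [folklore] -/
theorem row_tangency_at_planar_move (hs : IsRoot q s₀) (W : ForcedWalk q s₀) (t : ℕ) (hjt : W.j t = j)
    (hbk : W.b t k = 0) (hex : ordZero (W.st (t + 1)).F ≠ (q : ℕ∞)) {n : ℕ} (hqn : q < n) (hn2 : n < 2 * q)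
    {l : ℕ} (hl : l + n ≤ 2 * q) : (rowPoly i j k 0 n (W.b t i) (W.st t).F).coeff l = 0 := by
  have hF : ∀ d ∈ (W.st t).F.support, q ≤ d.degree := fun d hd => le_degree_of_mem_support hs W t hd
  have hF' : ∀ d ∈ (step q j (W.b t) (W.st t)).F.support, q < d.degree := by
    intro d hd
    rw [← hjt, ← st_succ_F] at hd
    exact lt_degree_of_excess hs W (t + 1) hex hd
  exact rowPoly_coeff_eq_zero_of_excess hij hjk hik q (W.b t) (by rw [← hjt]; exact W.onExc t) hbk (W.st t) hF
    hF' hqn hn2 hl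

/-- **REACH (PROVED, walk form):** … hence every non-empty row `q < n < 2q` of layer `0` of `F_t` has an exponent
with `d_i ≥ 2q + 1 − n`. [new] [folklore] -/
theorem row_reach_at_planar_move (hs : IsRoot q s₀) (W : ForcedWalk q s₀) (t : ℕ) (hjt : W.j t = j)
    (hbk : W.b t k = 0) (hex : ordZero (W.st (t + 1)).F ≠ (q : ℕ∞)) {n : ℕ} (hqn : q < n) (hn2 : n < 2 * q)
    (hne : ((layer k 0 (W.st t).F).filter (fun d => d i + d j = n)).Nonempty) :
    ∃ d ∈ (layer k 0 (W.st t).F).filter (fun d => d i + d j = n), 2 * q + 1 ≤ d i + n := by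
  have hF : ∀ d ∈ (W.st t).F.support, q ≤ d.degree := fun d hd => le_degree_of_mem_support hs W t hd
  have hF' : ∀ d ∈ (step q j (W.b t) (W.st t)).F.support, q < d.degree := by
    intro d hd
    rw [← hjt, ← st_succ_F] at hd
    exact lt_degree_of_excess hs W (t + 1) hex hd
  exact exists_reach_of_excess hij hjk hik q (W.b t) (by rw [← hjt]; exact W.onExc t) hbk (W.st t) hF hF' hqn
    hn2 hne

end TangencyWalk

end Summit.ResolutionOfSingularities.ResolutionOfSingularities.Theorems.CoefficientCut
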